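import Mathlib
import Summits.KontsevichZagierPeriods.Zeta5Search.LeadingDigitSeries
import HarnessLib

/-!
# ζ(5) search — CLASS-DIGIT LAW: the statements (the (D) list of `denom-law/CLASS-DIGIT-LAW.md` §7)

Cell `pub-zeta5`, track DENOM-LAW (D1; denom-theory-d1 g3/g4 statements, g5 filing split).  HONEST FRAMING: systematic search;
identities and `p`-adic valuations of the cell's own partial-fraction coefficients `c_{σ−1,q}` of Brown–Zudilin-type rational
functions (rational numbers); nothing about ζ(5); no irrationality claim; records in print UNMOVED.

The 22 declarations below are VERBATIM those of `denom-law/code/d1g4/lean/ClassDigitLawSketch4.lean` (sha16 c04f5b1a894f4427):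
8 definitions (`foreignSeries`, `truncPole`, `depthSum`, `digitSum`, `classVHat`, `foreignS1`, `classRhoNext`, `digitSum2`) and
14 `@[conjecture]` statements, every one of which is proved in `ClassDigitLawProof.lean` (`theorem …_holds`).  What they say:
the partial-fraction coefficient at a pole `q` of order `n_q` is `(−p)^{σ+E_x}` times a coefficient of (class cofactor) × (foreign
factor series) (`PoleExpansion`, exact); the foreign series has `[ε^j] ∈ p^j ℤ_(p)` and the class cofactor is `p`-integral in the
window `p² > b₀ + 2`; hence the depth-`N` congruences `U ≡ depthSum N (mod p^{m+N})` (`DepthCongruenceU/W`), whose `N = 1, 2`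
readings in closed form are `DigitCongruenceU/W` and `SecondDigitCongruenceU/W` (`[ε¹] g = −p ĝ S₁`); `LeadingDigitV` is the
analogous first digit of the `V` functional.  OBSERVED, not claimed: that depth `N ≤ 4` decides the valuation (the sealed scores).
-/

noncomputable section

open Finset PowerSeries

namespace Summit.KontsevichZagierPeriods.Zeta5Search.ClassDigitLaw

open Summit.KontsevichZagierPeriods.Zeta5Search.CasoratianValuation (InPolytope)
open Summit.KontsevichZagierPeriods.Zeta5Search.WedgeDictionary (coeffU coeffW pfData)
open Summit.KontsevichZagierPeriods.Zeta5Search.ClusterValuation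
open Literature.NumberTheory.Transcendental.BallRivoal (harm)

/-- The FOREIGN FACTOR SERIES at the pole `q`: `g_{x,q}(ε) = 2 · ∏_{s ≤ b₀, s ∉ class(q)} ((s − q) − pε)^{netExp s} · [((b₀/2 − q) − pε)]`
(the bracket only for the odd centre outside the class); `g_{x,q}(0) = ĝ_q` (`gHat`), and `[ε^j] g_{x,q} ∈ p^j ĝ_q ℤ_(p)`. -/
noncomputable def foreignSeries (b : ℕ → ℤ) (p q : ℕ) : PowerSeries ℚ :=
  2 * (∏ s ∈ (range ((b 0).toNat + 1)).filter (fun s => s % p ≠ q % p),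
        PowerSeries.rescale (-(p : ℚ)) (binomSeries ((s : ℚ) - q) (netExp b s)))
    * (if ¬ (2 : ℤ) ∣ b 0 ∧ ¬ CentreIn b p q then PowerSeries.rescale (-(p : ℚ)) (binomSeries ((b 0 : ℚ) / 2 - q) 1) else 1)

/-- **DICTIONARY LEMMA (the one new identity)**: the sketch's foreign factor series is the tree's far part rescaled by `−p`. -/
@[conjecture] def ForeignSeriesDict : Prop :=
  ∀ (b : ℕ → ℤ) (p q : ℕ), p.Prime → 0 ≤ b 0 → q ≤ (b 0).toNat →
    foreignSeries b p q = PowerSeries.rescale (-(p : ℚ)) (Gfar b p q)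

/-- **POLE EXPANSION (exact; g7 §2.3)**: in the window `p² > b₀+2`, for every pole `q` and `1 ≤ σ ≤ n_q`:
`c_{σ−1,q} = (−p)^{σ+E_x} · [ε^{n_q−σ}] (G_q(ε) · g_{x,q}(ε))`. -/
@[conjecture] def PoleExpansion : Prop :=
  ∀ (b : ℕ → ℤ) (p q σ : ℕ), InPolytope b → p.Prime → 5 ≤ p → (b 0 + 2 : ℤ) < (p : ℤ) ^ 2 →
    q ≤ (b 0).toNat → 1 ≤ σ → (σ : ℤ) ≤ -netExp b q →
      pfData b (σ - 1) q =
        (-(p : ℚ)) ^ ((σ : ℤ) + classExp b p q) *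
          PowerSeries.coeff ((-netExp b q).toNat - σ) (classCofactor b p q * foreignSeries b p q)

/-- **TOP COEFFICIENT (exact; the order-`n_q` case of `PoleExpansion`)**: `c_{n_q−1,q} = (−p)^{n_q+E_x} ĝ_q ρ_{q,n_q}`. -/
@[conjecture] def TopCoefficient : Prop :=
  ∀ (b : ℕ → ℤ) (p q : ℕ), InPolytope b → p.Prime → 5 ≤ p → (b 0 + 2 : ℤ) < (p : ℤ) ^ 2 →
    q ≤ (b 0).toNat → netExp b q < 0 →
      pfData b ((-netExp b q).toNat - 1) q =
        (-(p : ℚ)) ^ (-netExp b q + classExp b p q) * gHat b p q * classRho b p q (-netExp b q).toNat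

/-- The pole expansion at `q` for the order-`σ` coefficient, with the foreign series truncated after `N` terms (`[ε^j] g_{x,q}`, `j < N`). -/
noncomputable def truncPole (N : ℕ) (b : ℕ → ℤ) (p q σ : ℕ) : ℚ :=
  (-(p : ℚ)) ^ ((σ : ℤ) + classExp b p q) *
    PowerSeries.coeff ((-netExp b q).toNat - σ)
      (classCofactor b p q * ((PowerSeries.trunc N (foreignSeries b p q) : Polynomial ℚ) : PowerSeries ℚ))

/-- Depth-`N` digit sum for the order-`σ` coefficient: every pole of order `≥ σ` contributes its truncated expansion. -/
noncomputable def depthSum (N : ℕ) (b : ℕ → ℤ) (p σ : ℕ) : ℚ :=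
  ∑ q ∈ (range ((b 0).toNat + 1)).filter (fun q => netExp b q ≤ -(σ : ℤ)), truncPole N b p q σ

/-- **FOREIGN INTEGRALITY** (window `p² > b₀ + 2`): `[ε^j] g_{x,q} ∈ p^j ℤ_(p)`. -/
@[conjecture] def ForeignIntegrality : Prop :=
  ∀ (b : ℕ → ℤ) (p q j : ℕ), InPolytope b → p.Prime → 5 ≤ p → (b 0 + 2 : ℤ) < (p : ℤ) ^ 2 → q ≤ (b 0).toNat →
    PowerSeries.coeff j (foreignSeries b p q) ≠ 0 → (j : ℤ) ≤ padicValRat p (PowerSeries.coeff j (foreignSeries b p q))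

/-- **CLASS INTEGRALITY** (window): the class cofactor `G_q(ε)` has `p`-integral coefficients. -/
@[conjecture] def ClassIntegrality : Prop :=
  ∀ (b : ℕ → ℤ) (p q i : ℕ), InPolytope b → p.Prime → 5 ≤ p → (b 0 + 2 : ℤ) < (p : ℤ) ^ 2 → q ≤ (b 0).toNat →
    PowerSeries.coeff i (classCofactor b p q) ≠ 0 → 0 ≤ padicValRat p (PowerSeries.coeff i (classCofactor b p q))

/-- **DEPTH-`N` CONGRUENCE for `U`** (the class-digit law v4 as one statement): if every pole of order `≥ 5` has `5 + E ≥ m`, then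
`U ≡ depthSum N (σ = 5) (mod p^{m+N})`. -/
@[conjecture] def DepthCongruenceU : Prop :=
  ∀ (N : ℕ) (b : ℕ → ℤ) (p : ℕ) (m : ℤ), InPolytope b → p.Prime → 5 ≤ p → (b 0 + 2 : ℤ) < (p : ℤ) ^ 2 →
    (∀ q, q ≤ (b 0).toNat → netExp b q ≤ -5 → m ≤ 5 + classExp b p q) →
      coeffU b - depthSum N b p 5 ≠ 0 → m + N ≤ padicValRat p (coeffU b - depthSum N b p 5)

/-- **DEPTH-`N` CONGRUENCE for `W`** (σ = 3). -/
@[conjecture] def DepthCongruenceW : Prop :=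
  ∀ (N : ℕ) (b : ℕ → ℤ) (p : ℕ) (m : ℤ), InPolytope b → p.Prime → 5 ≤ p → (b 0 + 2 : ℤ) < (p : ℤ) ^ 2 →
    (∀ q, q ≤ (b 0).toNat → netExp b q ≤ -3 → m ≤ 3 + classExp b p q) →
      coeffW b - depthSum N b p 3 ≠ 0 → m + N ≤ padicValRat p (coeffW b - depthSum N b p 3)

/-- The first-order DIGIT SUM of the `ζ(σ)`-type coefficient at order `m`: `Σ_{q pole of order ≥ σ, σ + E_{class(q)} = m} ĝ_q ρ_{q,σ}`. -/
noncomputable def digitSum (b : ℕ → ℤ) (p σ : ℕ) (m : ℤ) : ℚ :=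
  ∑ q ∈ (range ((b 0).toNat + 1)).filter (fun q => netExp b q ≤ -(σ : ℤ) ∧ (σ : ℤ) + classExp b p q = m),
    gHat b p q * classRho b p q σ

/-- **CROSS-CLASS DIGIT CONGRUENCE FOR `U`**: if every pole `q` of order `≥ 5` has `5 + E_{class(q)} ≥ m`, then
`U(b) ≡ (−p)^m · digitSum(5, m) (mod p^{m+1})`. -/
@[conjecture] def DigitCongruenceU : Prop :=
  ∀ (b : ℕ → ℤ) (p : ℕ) (m : ℤ), InPolytope b → p.Prime → 5 ≤ p → (b 0 + 2 : ℤ) < (p : ℤ) ^ 2 →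
    (∀ q, q ≤ (b 0).toNat → netExp b q ≤ -5 → m ≤ 5 + classExp b p q) →
      coeffU b - (-(p : ℚ)) ^ m * digitSum b p 5 m ≠ 0 →
        m + 1 ≤ padicValRat p (coeffU b - (-(p : ℚ)) ^ m * digitSum b p 5 m)

/-- **CROSS-CLASS DIGIT CONGRUENCE FOR `W`** (the same with `σ = 3`). -/
@[conjecture] def DigitCongruenceW : Prop :=
  ∀ (b : ℕ → ℤ) (p : ℕ) (m : ℤ), InPolytope b → p.Prime → 5 ≤ p → (b 0 + 2 : ℤ) < (p : ℤ) ^ 2 →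
    (∀ q, q ≤ (b 0).toNat → netExp b q ≤ -3 → m ≤ 3 + classExp b p q) →
      coeffW b - (-(p : ℚ)) ^ m * digitSum b p 3 m ≠ 0 →
        m + 1 ≤ padicValRat p (coeffW b - (-(p : ℚ)) ^ m * digitSum b p 3 m)

/-- **COEFFICIENT FORM OF THE PARTIAL FRACTIONS at a pole of order `n_q ≥ σ ≥ 1`** (= `pf_eq_coeff_Gser` with the monomial shifted out):
`c_{σ−1,q} = [X^{n_q − σ}] Gser b q`. -/
@[conjecture] def PoleCoeffGser : Prop :=
  ∀ (b : ℕ → ℤ) (p q σ : ℕ), InPolytope b → p.Prime → 5 ≤ p → (b 0 + 2 : ℤ) < (p : ℤ) ^ 2 →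
    q ≤ (b 0).toNat → 1 ≤ σ → (σ : ℤ) ≤ -netExp b q →
      pfData b (σ - 1) q = PowerSeries.coeff ((-netExp b q).toNat - σ) (Gser b q)

/-- The `V`-DIGIT SUM `𝒱̂_x = Σ_{q∈class, pole} ĝ_q Σ_{σ ≤ n_q} (−1)^σ ρ_{q,σ} H^{(σ)}_{⌊q/p⌋}` (verbatim from the g4 sketch). -/
noncomputable def classVHat (b : ℕ → ℤ) (p x : ℕ) : ℚ :=
  ∑ q ∈ (classSet b p x).filter (fun q => netExp b q < 0),
    gHat b p q * ∑ σ ∈ range 7, (if 1 ≤ σ ∧ (σ : ℤ) ≤ -netExp b q then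
      (-1 : ℚ) ^ σ * classRho b p q σ * harm σ (q / p) else 0)

/-- **LEADING DIGIT OF `V_x` (REPORT-gen2-g7 §2.3, PROVED ON PAPER; denom-theory-d1 g3 check: the induced class orders and digits agree
with exact partial fractions on 180 cells and give `v_p(V)` exactly on 21,231 / 21,401 FEAT cells)**: in the window,
`V_x ≡ (−p)^{E_x} · 𝒱̂_x (mod p^{E_x+1})`.  (Split `H^{(σ)}_q = h_σ(q) + p^{−σ}H^{(σ)}_{⌊q/p⌋}` with `h_σ(q)` `p`-integral; the `h`-part is
`O(p^{1+E_x})` by Theorem A (multipole) / Theorem A′ (single pole); the level part is Theorem B summed over `σ`.) -/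
@[conjecture] def LeadingDigitV : Prop :=
  ∀ (b : ℕ → ℤ) (p x : ℕ), InPolytope b → p.Prime → 5 ≤ p → (b 0 + 2 : ℤ) < (p : ℤ) ^ 2 →
    x < p → 1 ≤ classPoleCount b p x →
      classV b p x - (-(p : ℚ)) ^ (classExp b p x) * classVHat b p x ≠ 0 →
        classExp b p x + 1 ≤ padicValRat p (classV b p x - (-(p : ℚ)) ^ (classExp b p x) * classVHat b p x)

/-- `S₁(q) = Σ_{s ≤ b₀, s ∉ class(q)} netExp s / (s − q) + [1/(b₀/2 − q)]` — the first foreign power sum (`[ε¹] g_{x,q} = −p ĝ_q S₁(q)`). -/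
noncomputable def foreignS1 (b : ℕ → ℤ) (p q : ℕ) : ℚ :=
  (∑ s ∈ (range ((b 0).toNat + 1)).filter (fun s => s % p ≠ q % p), (netExp b s : ℚ) / ((s : ℚ) - q))
    + (if ¬ (2 : ℤ) ∣ b 0 ∧ ¬ CentreIn b p q then 1 / ((b 0 : ℚ) / 2 - q) else 0)

/-- **SECOND DIGIT (corollary of `PoleExpansion`)**: for `1 ≤ σ < n_q`,
`v_p(c_{σ−1,q} − (−p)^{σ+E_x} ĝ_q (ρ_{q,σ} − p·S₁(q)·ρ_{q,σ+1})) ≥ σ + E_x + 2`.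
This is the per-pole statement behind the 'd2' branch of `duallaw3.law2` (at `σ = n_q` use `TopCoefficient`, which is exact). -/
@[conjecture] def SecondDigit : Prop :=
  ∀ (b : ℕ → ℤ) (p q σ : ℕ), InPolytope b → p.Prime → 5 ≤ p → (b 0 + 2 : ℤ) < (p : ℤ) ^ 2 →
    q ≤ (b 0).toNat → 1 ≤ σ → (σ : ℤ) + 1 ≤ -netExp b q →
      pfData b (σ - 1) q - (-(p : ℚ)) ^ ((σ : ℤ) + classExp b p q) * gHat b p q *
          (classRho b p q σ - (p : ℚ) * foreignS1 b p q * classRho b p q (σ + 1)) ≠ 0 →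
        (σ : ℤ) + classExp b p q + 2 ≤
          padicValRat p (pfData b (σ - 1) q - (-(p : ℚ)) ^ ((σ : ℤ) + classExp b p q) * gHat b p q *
            (classRho b p q σ - (p : ℚ) * foreignS1 b p q * classRho b p q (σ + 1)))

/-- `ρ_{q,σ+1}` with the convention `0` when `σ = n_q` (the tree's `classRho` truncates `toNat` and would return `G_q(0)` there). -/
noncomputable def classRhoNext (b : ℕ → ℤ) (p q σ : ℕ) : ℚ :=
  if (σ : ℤ) + 1 ≤ -netExp b q then classRho b p q (σ + 1) else 0

/-- SECOND-ORDER DIGIT SUM at level `m` for the order-`σ` coefficient: poles with `σ + E = m` contribute their first two digits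
`ĝ_q (ρ_{q,σ} − p S₁(q) ρ_{q,σ+1})`, poles with `σ + E = m + 1` their first digit times `(−p)`. -/
noncomputable def digitSum2 (b : ℕ → ℤ) (p σ : ℕ) (m : ℤ) : ℚ :=
  (∑ q ∈ (range ((b 0).toNat + 1)).filter (fun q => netExp b q ≤ -(σ : ℤ) ∧ (σ : ℤ) + classExp b p q = m),
      gHat b p q * (classRho b p q σ - (p : ℚ) * foreignS1 b p q * classRhoNext b p q σ))
  + ∑ q ∈ (range ((b 0).toNat + 1)).filter (fun q => netExp b q ≤ -(σ : ℤ) ∧ (σ : ℤ) + classExp b p q = m + 1),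
      (-(p : ℚ)) * gHat b p q * classRho b p q σ

/-- **SECOND DIGIT CONGRUENCE for `U`** (cell level; corollary of `ClusterBound` + `LeadingDigit` + `SecondDigit` + `TopCoefficient` summed over
the poles): if every pole of order `≥ 5` has `5 + E ≥ m`, then `U ≡ (−p)^m · digitSum2(5, m) (mod p^{m+2})`.  With `m = min(5+E)` this is the
statement behind the class-digit law v3: after a first-order cancellation (`p ∣ digitSum`) the valuation is `m+1` iff `p² ∤ (−p)^{-m}·digitSum2`-part,
i.e. the 'digit2' / 'lift2' branches. -/
@[conjecture] def SecondDigitCongruenceU : Prop :=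
  ∀ (b : ℕ → ℤ) (p : ℕ) (m : ℤ), InPolytope b → p.Prime → 5 ≤ p → (b 0 + 2 : ℤ) < (p : ℤ) ^ 2 →
    (∀ q, q ≤ (b 0).toNat → netExp b q ≤ -5 → m ≤ 5 + classExp b p q) →
      coeffU b - (-(p : ℚ)) ^ m * digitSum2 b p 5 m ≠ 0 → m + 2 ≤ padicValRat p (coeffU b - (-(p : ℚ)) ^ m * digitSum2 b p 5 m)

/-- **SECOND DIGIT CONGRUENCE for `W`** (σ = 3). -/
@[conjecture] def SecondDigitCongruenceW : Prop :=
  ∀ (b : ℕ → ℤ) (p : ℕ) (m : ℤ), InPolytope b → p.Prime → 5 ≤ p → (b 0 + 2 : ℤ) < (p : ℤ) ^ 2 →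
    (∀ q, q ≤ (b 0).toNat → netExp b q ≤ -3 → m ≤ 3 + classExp b p q) →
      coeffW b - (-(p : ℚ)) ^ m * digitSum2 b p 3 m ≠ 0 → m + 2 ≤ padicValRat p (coeffW b - (-(p : ℚ)) ^ m * digitSum2 b p 3 m)

end Summit.KontsevichZagierPeriods.Zeta5Search.ClassDigitLaw

end
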